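import Summits.QuantumFields.YangMills.Theorems.UnitScaleTiltHistoryTailLaneTailInt
import Summits.QuantumFields.YangMills.Theorems.AlphaInputsT3ACv3Chi
import HarnessLib

/-!
# Route `UnitScaleTilt` — crux K2-L `HistoryTailL` (stmt-QuantumFields-19936), R-57χ (owner RULING g23-№2 + ADDENDA 2/5/6; R57chi/README «TO COME … (19936 lineage)»):
# **THE CRUX MODULO THE χ-RECORD** — `historyTailL_of_laneRecordsChi : (∀ L, Odd L → 1 < L → AlphaInputsT3ACv3RecChi L) → …Theses.UnitScaleTilt.HistoryTailL`
# = the two-line closer the successor skeleton v5p9 = {2′χ} composes (`HistoryTailL_of := historyTailL_of_laneRecordsChi stub_laneRecordsV3chi`) — seat ym3-torus-p2 (g16); `--supports` 19936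

The χ-record `AlphaInputsT3AC.OfV3ChiAt F 𝔠 a₀ a₁` (★alpha-1's `AlphaInputsT3ACv3Chi`: print's lower row on print's validity family, [Balaban1985UV3] (47) p.267 with «χ·χ_k»)
instantiates the record-free interior socket `AlphaInputsT3AC.IntCoreRec` of `…HistoryTailIntData`: the family of data cores is `fun K ↦ (hχ.pkgAtV3Chi hc γ hγ hγ1 K).toCore`
(its `a₁` is the given one, `pkgAtV3Chi_a₁`), and the lower a.e. row (47)′ for the INTERIOR datum `dataIntV3` is ★alpha-1's `PkgAtV3Chi.le_resDensity_int_ae` VERBATIM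
(the interior indicator `𝟙[intWindowT3]` is `dataIntV3`'s `χ` by `rfl`; negation-lens pre-check N-g24-3) under the data-smallness binder `θBal ≤ a₁` of [Balaban1985Variational]
Thm 1 (8), which `…LaneTailInt.perPlaquetteHigh_int` discharges by its coupling threshold.  Hence `intCoreRec_of_laneRecordsChi` and **`historyTailL_of_laneRecordsChi`**:
19936 is PROVED modulo the χ-lane's END theorem `AlphaInputsT3ACv3RecChi` (NODE O's d = 3 (α) record with print's lower row) and nothing else.  Nothing of [Balaban1985UV3] is
asserted. [cite: Balaban1985UV3, (5) p.256, (47) p.267, (71) p.273 and Thm 2 p.272; Balaban1985Variational, Thm 1 (8) p.279; King1986, (3.12) p.657]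
-/

set_option autoImplicit false

noncomputable section

open MeasureTheory
open Literature.MathematicalPhysics.QuantumFieldTheory.Balaban1983to89
open Literature.MathematicalPhysics.QuantumFieldTheory.Balaban1983to89.T3ContinuumYM3Torus
open Literature.MathematicalPhysics.QuantumFieldTheory.Balaban1983to89.T3UnitScaleTilt (θBal)
open Literature.MathematicalPhysics.QuantumFieldTheory.Balaban1983to89.T3AlphaInputsAC
open Summit.QuantumFields.Balaban3D.Carriers (suGroupModel Hist)
open Summit.QuantumFields.Balaban3D.Proofs.Primitives (AlphaConsts)
open Summit.QuantumFields.YangMills.Theorems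

namespace Summit.QuantumFields.YangMills.Theorems.HistoryTailLaneTailChi

/-- **THE INTERIOR (47)′ ROW OF THE χ-RECORD'S DATUM**: for a χ-package `p : PkgAtV3Chi F 𝔠 γ hγ hγ1 K` placed at height `K` of any family of data cores `qf` with
`qf K = p.toCore`, the interior datum `dataIntV3 qf π` satisfies `Ineq47AE` at every level `j ≤ K` under `θBal ≤ p.a₁` — ★alpha-1's `PkgAtV3Chi.le_resDensity_int_ae`
(the interior indicator IS the datum's `χ`, `rfl`). [cite: Balaban1985UV3, (47) p.267 and Thm 2 p.272; Balaban1985Variational, Thm 1 (8) p.279] -/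
theorem dataIntV3_ineq47AE_of_chi {F : T3Family} {𝔠 : AlphaConsts F.L (suGroupModel 2).N} {γ : ℝ} {hγ : 0 < γ} {hγ1 : γ ≤ (min 𝔠.gamma0 1) ^ 2}
    (qf : ∀ K, AlphaInputsT3AC.PkgCoreV3 F 𝔠 γ hγ hγ1 K) (π : AlphaInputsT3AC.PolymerT3 F) (K : ℕ)
    (p : AlphaInputsT3AC.PkgAtV3Chi F 𝔠 γ hγ hγ1 K) (hp : qf K = p.toCore)
    (ha₁ : ∀ i, θBal F.L γ 𝔠.b₀ 𝔠.p₀ i ≤ p.a₁) (j : ℕ) (hj : j ≤ K) :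
    Ineq47AE (AlphaInputsT3AC.dataIntV3 qf π) K j := by
  have h := p.le_resDensity_int_ae ha₁ j hj
  show ∀ᵐ W ∂fieldMeasure (F.P K) j (Matrix.specialUnitaryGroup (Fin 2) ℂ),
    Real.exp (-((qf K).T.Ecst j - (qf K).E) - (qf K).T.Rm j) *
        ({V : GaugeField (F.P K) j (Matrix.specialUnitaryGroup (Fin 2) ℂ) |
            PlaqSmall (θBal F.L γ 𝔠.b₀ 𝔠.p₀ (K - j) / max 𝔠.B₃ 1) V}.indicator (fun _ => (1 : ℝ)) W *
          Real.exp (-((qf K).T.mainT j (Hist.triv (F.P K) j) W) + (qf K).T.Pint j (Hist.triv (F.P K) j) W)) ≤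
      T3RestrictedUnitDensity.resDensity F γ K Set.univ j W
  rw [hp]
  exact h

/-- **THE χ-RECORD INSTANTIATES THE RECORD-FREE INTERIOR SOCKET**: `AlphaInputsT3ACv3RecChi L → AlphaInputsT3AC.IntCoreRec L` — data cores `(pkgAtV3Chi …).toCore`, constant `a₁` by
`pkgAtV3Chi_a₁`, interior (47)′ by `dataIntV3_ineq47AE_of_chi`. [cite: Balaban1985UV3, (47) p.267 and Thm 2 p.272; Balaban1985Variational, Thm 1 (8) p.279] -/
theorem intCoreRec_of_laneRecordsChi (L : ℕ) (h : Summit.QuantumFields.YangMills.Theorems.AlphaInputsT3ACv3RecChi L) :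
    AlphaInputsT3AC.IntCoreRec L := by
  obtain ⟨b₁, p₁, h⟩ := h
  refine ⟨b₁, p₁, fun b₀ p₀ hb hp => ?_⟩
  obtain ⟨𝔠, a₀, a₁, hcb, hcp, ha0, ha1, hw, hF⟩ := h b₀ p₀ hb hp
  refine ⟨𝔠, a₁, hcb, hcp, ha1, fun F hFL γ hγ hγ1 => ?_⟩
  subst hFL
  have hχ : AlphaInputsT3AC.OfV3ChiAt F 𝔠 a₀ a₁ := hF F rfl
  have hc : 0 < a₀ ∧ 0 < a₁ ∧ 𝔠.B₃ * a₁ ≤ a₀ := ⟨ha0, ha1, hw⟩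
  refine ⟨fun K => (hχ.pkgAtV3Chi hc γ hγ hγ1 K).toCore, fun K => hχ.pkgAtV3Chi_a₁ hc γ hγ hγ1 K, fun ha π K j hj => ?_⟩
  refine dataIntV3_ineq47AE_of_chi _ π K (hχ.pkgAtV3Chi hc γ hγ hγ1 K) rfl (fun i => ?_) j hj
  rw [hχ.pkgAtV3Chi_a₁ hc γ hγ hγ1 K]
  exact ha i

/-- **`HistoryTailL ⇐ stub_laneRecordsV3chi` ALONE** — the closer v5p9 = {2′χ} composes: `…LaneTailInt.historyTailL_of_intCoreRec` on `intCoreRec_of_laneRecordsChi`.  The v3′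
load-bearing item stmt-QuantumFields-19936 BY NAME, CONDITIONAL on the χ-lane's END theorem `AlphaInputsT3ACv3RecChi L` for every odd `L > 1` (the successor stub 2′χ).
[cite: Balaban1985UV3, (5) p.256, (47) p.267 and (71) p.273; King1986, (3.12) p.657] -/
theorem historyTailL_of_laneRecordsChi (hrec : ∀ L : ℕ, Odd L → 1 < L → Summit.QuantumFields.YangMills.Theorems.AlphaInputsT3ACv3RecChi L) :
    Summit.QuantumFields.YangMills.Theses.UnitScaleTilt.HistoryTailL :=
  HistoryTailLaneTailInt.historyTailL_of_intCoreRec fun L hLo hL => intCoreRec_of_laneRecordsChi L (hrec L hLo hL)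

end Summit.QuantumFields.YangMills.Theorems.HistoryTailLaneTailChi

end
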